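import Mathlib.GroupTheory.Sylow
import Summits.HodgeConjecture.CorCM.Census.TypeStabiliserTwist

/-!
# `𝒦(G,c)` is controlled by a Sylow `2`-subgroup: `G/𝒦(G,c)` is a quotient of `S/𝒦(S,c)`

COR-CM (cell `pub-hodgecm2`), count-neutral kernel combinatorics by the census seat lit-andre-3 (gen 23; lane
TYPE-STABILISER-SYLOW), sequel of `Census/TypeStabiliserSubgroup.lean` (the subgroup `𝒦(G,c) = stabGen c = ⟨c, {g | c ∉ ⟨g⟩}⟩`)
and `Census/TypeStabiliserTwist.lean` (`𝒦` of a subgroup maps into `𝒦`).  Pure group theory; theorems only (no definition, no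
`decide`, no certificate, no named fact, no `sorry`).
HONEST FRAMING: `HC_CM` is NOT proved, here or anywhere in the tree; nothing here is a period or a headline.

THE POINT (memo `HOME/pub-hodgecm2-lit-andre-3/PORTFOLIO-lit-andre-3-g23.md` §2.1).  The census sentences about `dim 𝔛 = d(Gal/𝒦)`
(`Census/TypeStabiliserCharK`) are computed over `2`-groups; for the Galois group `G` of an arbitrary Galois CM field (any finite
group with a central involution `c`) the question reduces to a Sylow `2`-subgroup `S ∋ c`:
* every element of odd order lies in `𝒦(G,c)` (`mem_stabGen_of_odd_orderOf`, previous file), hence **`G ⧸ 𝒦(G,c)` is a `2`-group**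
  (`isPGroup_quotient_stabGen`) and **`[G : 𝒦(G,c)]` is a power of `2`** (`index_stabGen_eq_two_pow`);
* therefore **`S ⊔ 𝒦(G,c) = G`** for every Sylow `2`-subgroup `S` (`sylow_sup_stabGen_eq_top`: the index of `S ⊔ 𝒦` divides the odd
  number `[G:S]` and the `2`-power `[G:𝒦]`), the restriction **`S → G ⧸ 𝒦(G,c)` is surjective** (`mk_subtype_surjective`), and it
  kills `𝒦(S,c)` (roots of `c` are the same in `S` and in `G`, `map_subtype_stabGen_le`);
* so **`G ⧸ 𝒦(G,c)` is a quotient of `S ⧸ 𝒦(S,c)`** (`quotientMap_surjective`): in particular `d(G/𝒦(G,c)) ≤ d(S/𝒦(S,c))` and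
  `|G/𝒦(G,c)|` divides `|S/𝒦(S,c)|` (`card_quotient_stabGen_dvd`) — upper bounds proved for `2`-groups hold for all groups.

## References
* [Pohlmann1968] H. Pohlmann, Algebraic cycles on abelian varieties of complex multiplication type, Ann. of Math. 88 (1968), Thm 1.
* [Milne1999] J. S. Milne, Lefschetz motives and the Tate conjecture, Compositio Math. 117 (1999), Prop. 2.1, p. 54.
-/

namespace Summit.HodgeConjecture.CorCM.Census.TypeStabiliser

section Sylow

variable {G : Type*} [Group G] (c : G)

/-- In a finite group every element has a `2`-power power of odd order: `g ^ (2 ^ k)` has odd order for some `k`. [folklore] -/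
theorem exists_pow_two_pow_odd_orderOf [Finite G] (g : G) : ∃ k : ℕ, Odd (orderOf (g ^ (2 ^ k))) := by
  obtain ⟨k, m, hm, hkm⟩ := Nat.exists_eq_two_pow_mul_odd (orderOf_pos g).ne'
  refine ⟨k, Odd.of_dvd_nat hm (orderOf_dvd_of_pow_eq_one ?_)⟩
  rw [← pow_mul, ← hkm, pow_orderOf_eq_one]

/-- **`G ⧸ 𝒦(G,c)` is a `2`-group** (`c` a central involution `≠ 1`): the odd-order power `g ^ (2 ^ k)` of any `g` lies in `𝒦`.
[folklore] -/
theorem isPGroup_quotient_stabGen [Finite G] (hc2 : c * c = 1) (hc1 : c ≠ 1) [(stabGen c).Normal] :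
    IsPGroup 2 (G ⧸ stabGen c) := by
  intro x
  obtain ⟨g, rfl⟩ := QuotientGroup.mk_surjective x
  obtain ⟨k, hk⟩ := exists_pow_two_pow_odd_orderOf g
  refine ⟨k, ?_⟩
  rw [← QuotientGroup.mk_pow, QuotientGroup.eq_one_iff]
  exact mem_stabGen_of_odd_orderOf c hc2 hc1 hk

/-- **`[G : 𝒦(G,c)]` is a power of `2`.** [folklore] -/
theorem index_stabGen_eq_two_pow [Finite G] (hc2 : c * c = 1) (hc1 : c ≠ 1) (hcen : ∀ x : G, x * c = c * x) :
    ∃ n : ℕ, (stabGen c).index = 2 ^ n := by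
  haveI := stabGen_normal c hcen
  obtain ⟨n, hn⟩ := IsPGroup.iff_card.mp (isPGroup_quotient_stabGen c hc2 hc1)
  exact ⟨n, by rw [Subgroup.index_eq_card]; exact hn⟩

/-- **`S ⊔ 𝒦(G,c) = G` for every Sylow `2`-subgroup `S`**: the index of `S ⊔ 𝒦` divides the odd index of `S` and the `2`-power
index of `𝒦`. [folklore] -/
theorem sylow_sup_stabGen_eq_top [Finite G] (hc2 : c * c = 1) (hc1 : c ≠ 1) (hcen : ∀ x : G, x * c = c * x)
    (S : Sylow 2 G) : (S : Subgroup G) ⊔ stabGen c = ⊤ := by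
  obtain ⟨n, hn⟩ := index_stabGen_eq_two_pow c hc2 hc1 hcen
  have h1 : ((S : Subgroup G) ⊔ stabGen c).index ∣ (S : Subgroup G).index := Subgroup.index_dvd_of_le le_sup_left
  have h2 : ((S : Subgroup G) ⊔ stabGen c).index ∣ 2 ^ n := hn ▸ Subgroup.index_dvd_of_le le_sup_right
  have hS : ¬ 2 ∣ (S : Subgroup G).index := S.not_dvd_index
  obtain ⟨k, -, hk⟩ := (Nat.dvd_prime_pow Nat.prime_two).mp h2
  rw [← Subgroup.index_eq_one, hk]
  rcases k with - | k
  · rfl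
  · exact absurd ((dvd_pow_self 2 (Nat.succ_ne_zero k)).trans (hk ▸ h1)) hS

/-- **The restriction `S → G ⧸ 𝒦(G,c)` is surjective** for every Sylow `2`-subgroup `S` (`G = S·𝒦`, `𝒦` being normal). [folklore] -/
theorem mk_subtype_surjective [Finite G] (hc2 : c * c = 1) (hc1 : c ≠ 1) (hcen : ∀ x : G, x * c = c * x)
    [(stabGen c).Normal] (S : Sylow 2 G) :
    Function.Surjective (QuotientGroup.mk ∘ (S : Subgroup G).subtype : S → G ⧸ stabGen c) := by
  intro x
  obtain ⟨g, rfl⟩ := QuotientGroup.mk_surjective x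
  have hg : g ∈ ((↑((S : Subgroup G) ⊔ stabGen c)) : Set G) := by
    rw [sylow_sup_stabGen_eq_top c hc2 hc1 hcen S]; exact Subgroup.mem_top g
  rw [Subgroup.mul_normal] at hg
  obtain ⟨s, hs, k, hk, rfl⟩ := Set.mem_mul.mp hg
  refine ⟨⟨s, hs⟩, ?_⟩
  change QuotientGroup.mk s = QuotientGroup.mk (s * k)
  rw [QuotientGroup.eq, ← mul_assoc, inv_mul_cancel, one_mul]
  exact hk

/-- Roots of `c` are the same in a subgroup `S ∋ c` and in `G`: **`𝒦(S,c) ≤ 𝒦(G,c) ∩ S`**, in `comap` form. [folklore] -/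
theorem stabGen_le_comap_subtype (S : Subgroup G) (hc : c ∈ S) :
    stabGen (⟨c, hc⟩ : S) ≤ (stabGen c).comap S.subtype := by
  rw [← Subgroup.map_le_iff_le_comap]
  exact map_subtype_stabGen_le S ⟨c, hc⟩

/-- **`G ⧸ 𝒦(G,c)` is a quotient of `S ⧸ 𝒦(S,c)`** for every Sylow `2`-subgroup `S ∋ c`: the map induced by the inclusion `S ≤ G` on the
quotients is a surjective homomorphism. [folklore] -/
theorem quotientMap_surjective [Finite G] (hc2 : c * c = 1) (hc1 : c ≠ 1) (hcen : ∀ x : G, x * c = c * x) (S : Sylow 2 G)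
    (hc : c ∈ (S : Subgroup G)) [(stabGen c).Normal] [(stabGen (⟨c, hc⟩ : (S : Subgroup G))).Normal] :
    Function.Surjective (QuotientGroup.map (stabGen (⟨c, hc⟩ : (S : Subgroup G))) (stabGen c) (S : Subgroup G).subtype
      (stabGen_le_comap_subtype c S hc)) :=
  QuotientGroup.map_surjective_of_surjective _ _ _ (mk_subtype_surjective c hc2 hc1 hcen S) _

/-- `𝒦(S,c)` is normal in `S` (the centrality hypothesis restricts to `S`). [folklore] -/
theorem stabGen_subtype_normal (hcen : ∀ x : G, x * c = c * x) (S : Subgroup G) (hc : c ∈ S) :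
    (stabGen (⟨c, hc⟩ : S)).Normal :=
  stabGen_normal _ fun x => Subtype.ext (hcen x)

/-- **`|G ⧸ 𝒦(G,c)|` divides `|S ⧸ 𝒦(S,c)|`** for every Sylow `2`-subgroup `S ∋ c` of a finite group. [folklore] -/
theorem card_quotient_stabGen_dvd [Finite G] (hc2 : c * c = 1) (hc1 : c ≠ 1) (hcen : ∀ x : G, x * c = c * x) (S : Sylow 2 G)
    (hc : c ∈ (S : Subgroup G)) [(stabGen c).Normal] [(stabGen (⟨c, hc⟩ : (S : Subgroup G))).Normal] :
    Nat.card (G ⧸ stabGen c) ∣ Nat.card ((S : Subgroup G) ⧸ stabGen (⟨c, hc⟩ : (S : Subgroup G))) :=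
  Subgroup.card_dvd_of_surjective _ (quotientMap_surjective c hc2 hc1 hcen S hc)

/-- The hypothesis `c ∈ S` is free: a central `2`-element lies in every Sylow `2`-subgroup. [folklore] -/
theorem mem_sylow_of_central [Finite G] (hc2 : c * c = 1) (hcen : ∀ x : G, x * c = c * x) (S : Sylow 2 G) :
    c ∈ (S : Subgroup G) := by
  -- `⟨c⟩ ⊔ S` is a `2`-group containing `S`, hence equals `S` by maximality.
  have hnorm : (S : Subgroup G) ≤ Subgroup.normalizer (Subgroup.zpowers c) := by
    intro s _
    have hs : ∀ k : ℤ, Commute s (c ^ k) := fun k => (show Commute s c from hcen s).zpow_right k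
    rw [Subgroup.mem_normalizer_iff]
    intro x
    constructor
    · intro hx
      obtain ⟨k, rfl⟩ := Subgroup.mem_zpowers_iff.mp hx
      refine Subgroup.mem_zpowers_iff.mpr ⟨k, ?_⟩
      rw [(hs k).eq, mul_inv_cancel_right]
    · intro hx
      obtain ⟨k, hk⟩ := Subgroup.mem_zpowers_iff.mp hx
      refine Subgroup.mem_zpowers_iff.mpr ⟨k, ?_⟩
      have e1 : x = s⁻¹ * (s * x * s⁻¹) * s := by group
      rw [e1, ← hk, mul_assoc, ← (hs k).eq, ← mul_assoc, inv_mul_cancel, one_mul]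
  have h2 : IsPGroup 2 (Subgroup.zpowers c) := by
    intro x
    refine ⟨1, ?_⟩
    obtain ⟨k, hk⟩ := Subgroup.mem_zpowers_iff.mp x.2
    apply Subtype.ext
    rw [pow_one, Subgroup.coe_pow, Subgroup.coe_one, ← hk, ← zpow_natCast, ← zpow_mul, Nat.cast_ofNat, mul_comm, zpow_mul,
      zpow_two, hc2, one_zpow]
  have hsup : IsPGroup 2 ((S : Subgroup G) ⊔ Subgroup.zpowers c : Subgroup G) :=
    IsPGroup.to_sup_of_normal_right' S.isPGroup' h2 hnorm
  have heq : ((S : Subgroup G) ⊔ Subgroup.zpowers c : Subgroup G) = S := S.is_maximal' hsup le_sup_left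
  rw [← heq]
  exact Subgroup.mem_sup_right (Subgroup.mem_zpowers c)

end Sylow

end Summit.HodgeConjecture.CorCM.Census.TypeStabiliser
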